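import Summits.NavierStokesRegularity.NavierStokesRegularity.Theorems.PalasekTowerBreakdownEpisodeBaseGerm

/-!
# `EpisodeBase` BY NAME from the REGISTERED STUB of line `slot` (skeleton v4, crux stmt-NavierStokesRegularity-19179)

Cell `ns-blowup`, seat `ns-palasek-19179-p2` (g0; holder of record of the crux `EpisodeBase` of the route
`PalasekTowerBreakdown`). Sequel of `PalasekTowerBreakdownEpisodeBaseGerm.lean` (ecbridge-3 g3: the crux BY NAME from
ONE level witness of a — possibly re-pushed — germ schedule of ANY profile in the strict slot `Germ.LevelZeroData`).
The v4 skeleton `Cruxes/EpisodeBase/Lines/slot.lean` (sha16 6becc362f8ae9286, `ledger skeleton check` OK 2026-08-26)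
registers ONE stub on the item, `stub_slot_pushed_levelWitness : SlotPushedLevelWitness`, whose statement is the nested
existential below; this file puts the two facts the registration rests on into importable by-name form:

* `palasekTowerBreakdown_episodeBase_of_exists_slot_pushed_levelWitness` — the registered stub's statement, verbatim
  as a nested `∃`, implies the route decl `EpisodeBase` (the skeleton's composition `EpisodeBase_of`);
* `palasekTowerBreakdown_exists_slot_pushed_of_exists_slot_levelWitness` — the UNPUSHED form (a level witness of the
  germ schedule under its own faded force) implies the registered (pushed) form: re-push by the schedule's own force
  and push constant (the re-pushed schedule is the schedule, by structure eta; confinement and silence from `τ₁` are the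
  germ host's `force_eq_zero_of_norm_gt` / `force_eq_zero_of_ge`). So the registered stub is the WEAKER of the two
  natural design-normal forms, and either closes the crux.

LABEL: E–C typing (KERNEL, proofs only, by name). WHAT THIS IS NOT: not Navier–Stokes evidence — implications whose
hypotheses are the OPEN episode of an unnamed design; nothing is asserted about any flow after `τ₀`, about `RungG 1`
or blow-up. HELPER for 19179 (`--supports`), closes nothing.

References: S. Palasek, arXiv:2605.13827 §3.3–§4 (Step 2) [cite: Palasek2026ElementaryModel, §4];
H. Sohr, *The Navier–Stokes Equations* (2001), Ch. V Thm. 1.5.1 [cite: Sohr2001, Ch. V Thm. 1.5.1].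
-/

noncomputable section

-- `Summit.<Summit>.<Problem>` is the tree's mandated summit-side namespace (CONVENTIONS §2); for this
-- single-conjunct summit the two coincide, so the duplicate is deliberate.
set_option linter.dupNamespace false

namespace Summit.NavierStokesRegularity.NavierStokesRegularity.Theorems

open Set Function
open Summit.NavierStokesRegularity.FluidComputer.PalasekTowerClayBridge
open Summit.NavierStokesRegularity.FluidComputer.PalasekTowerClayBridge.Germ
open Literature.Analysis.FluidPDE

/-- **`EpisodeBase` from the REGISTERED STUB of line `slot`** (its statement verbatim as a nested existential): SOME
profile `U` in the strict slot `Germ.LevelZeroData U ρ`, SOME push constant `c₄ ∈ (0, 1]`, SOME admissible re-push `g`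
of the germ schedule (`c ≤ c₁`, Clay class, silent from `T`, `‖g‖ ≤ c Y_k` on the windows, equal to the schedule's
force on `[0, τ₀]`, confined to the ball, zero from `τ₁` on) whose re-pushed schedule carries a level witness at level
`0` — gives the route's crux by name (`palasekTowerBreakdown_episodeBase_of_germ_repush_levelWitness`).
[cite: Palasek2026ElementaryModel, §4] -/
theorem palasekTowerBreakdown_episodeBase_of_exists_slot_pushed_levelWitness
    (hex : ∃ (U : EuclideanSpace ℝ (Fin 3) → EuclideanSpace ℝ (Fin 3)) (ρ c₄ : ℝ) (h : LevelZeroData U ρ)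
      (hc₄ : 0 < c₄) (hc₄' : c₄ ≤ 1) (c : ℝ) (hc : c ≤ (h.schedule c₄ hc₄ hc₄').c₁)
      (g : ℝ → EuclideanSpace ℝ (Fin 3) → EuclideanSpace ℝ (Fin 3))
      (h₁ : IsSmoothOnHalfSpace g) (h₂ : HasRapidSpaceTimeDecay g)
      (h₃ : ∀ t, (h.schedule c₄ hc₄ hc₄').T ≤ t → ∀ x, g t x = 0)
      (h₄ : ∀ k, ∀ t ∈ Icc ((h.schedule c₄ hc₄ hc₄').τ k) ((h.schedule c₄ hc₄ hc₄').τ (k + 1)), ∀ x,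
        ‖g t x‖ ≤ c * TowerRates.wide.Y k),
      (∀ t ∈ Icc 0 ((h.schedule c₄ hc₄ hc₄').τ 0), ∀ x, g t x = (h.schedule c₄ hc₄ hc₄').f t x) ∧
      (∀ t x, (h.schedule c₄ hc₄ hc₄').radius < ‖x‖ → g t x = 0) ∧
      (∀ t, (h.schedule c₄ hc₄ hc₄').τ 1 ≤ t → g t = 0) ∧
      ((h.schedule c₄ hc₄ hc₄').repush c hc g h₁ h₂ h₃ h₄).LevelWitness 1 0) :
    Summit.NavierStokesRegularity.NavierStokesRegularity.Theses.PalasekTowerBreakdown.EpisodeBase := by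
  obtain ⟨U, ρ, c₄, h, hc₄, hc₄', c, hc, g, h₁, h₂, h₃, h₄, hg, hgρ, hgq, hW⟩ := hex
  exact palasekTowerBreakdown_episodeBase_of_germ_repush_levelWitness h hc₄ hc₄' hc h₁ h₂ h₃ h₄ hg hgρ hgq hW

/-- **The unpushed form implies the registered (pushed) form**: if SOME profile in the strict slot has, at SOME push
constant, a level witness of its germ schedule under the schedule's OWN faded force, then the registered stub's
statement holds — re-push by the schedule's own force `S.f` and constant `S.c₄` (the re-pushed schedule is `S` by
structure eta); `S.f` is confined to the ball (`Germ.LevelZeroData.force_eq_zero_of_norm_gt`) and vanishes from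
`τ₁ = Host.τfirst` on (`Germ.LevelZeroData.force_eq_zero_of_ge`). [folklore] -/
theorem palasekTowerBreakdown_exists_slot_pushed_of_exists_slot_levelWitness
    (hex : ∃ (U : EuclideanSpace ℝ (Fin 3) → EuclideanSpace ℝ (Fin 3)) (ρ c₄ : ℝ) (h : LevelZeroData U ρ)
      (hc₄ : 0 < c₄) (hc₄' : c₄ ≤ 1), (h.schedule c₄ hc₄ hc₄').LevelWitness 1 0) :
    ∃ (U : EuclideanSpace ℝ (Fin 3) → EuclideanSpace ℝ (Fin 3)) (ρ c₄ : ℝ) (h : LevelZeroData U ρ)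
      (hc₄ : 0 < c₄) (hc₄' : c₄ ≤ 1) (c : ℝ) (hc : c ≤ (h.schedule c₄ hc₄ hc₄').c₁)
      (g : ℝ → EuclideanSpace ℝ (Fin 3) → EuclideanSpace ℝ (Fin 3))
      (h₁ : IsSmoothOnHalfSpace g) (h₂ : HasRapidSpaceTimeDecay g)
      (h₃ : ∀ t, (h.schedule c₄ hc₄ hc₄').T ≤ t → ∀ x, g t x = 0)
      (h₄ : ∀ k, ∀ t ∈ Icc ((h.schedule c₄ hc₄ hc₄').τ k) ((h.schedule c₄ hc₄ hc₄').τ (k + 1)), ∀ x,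
        ‖g t x‖ ≤ c * TowerRates.wide.Y k),
      (∀ t ∈ Icc 0 ((h.schedule c₄ hc₄ hc₄').τ 0), ∀ x, g t x = (h.schedule c₄ hc₄ hc₄').f t x) ∧
      (∀ t x, (h.schedule c₄ hc₄ hc₄').radius < ‖x‖ → g t x = 0) ∧
      (∀ t, (h.schedule c₄ hc₄ hc₄').τ 1 ≤ t → g t = 0) ∧
      ((h.schedule c₄ hc₄ hc₄').repush c hc g h₁ h₂ h₃ h₄).LevelWitness 1 0 := by
  obtain ⟨U, ρ, c₄, h, hc₄, hc₄', hW⟩ := hex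
  set S := h.schedule c₄ hc₄ hc₄' with hS
  refine ⟨U, ρ, c₄, h, hc₄, hc₄', S.c₄, S.c₄_le, S.f, S.force_smooth, S.force_decay, S.force_silent,
    S.push_small, fun _ _ _ => rfl, ?_, ?_, hW⟩
  · intro t x hx
    exact h.force_eq_zero_of_norm_gt hc₄ t x hx
  · intro t ht
    funext x
    have ht' : Host.τfirst ≤ t := ht
    exact h.force_eq_zero_of_ge hc₄ t ht' x

/-- **`EpisodeBase` from the unpushed form** (corollary: `…_of_exists_slot_levelWitness` composed with
`…_exists_slot_pushed_of_…`; equivalently ecbridge-3's `palasekTowerBreakdown_episodeBase_of_germ_levelWitness`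
under an `∃`). [cite: Palasek2026ElementaryModel, §4] -/
theorem palasekTowerBreakdown_episodeBase_of_exists_slot_levelWitness
    (hex : ∃ (U : EuclideanSpace ℝ (Fin 3) → EuclideanSpace ℝ (Fin 3)) (ρ c₄ : ℝ) (h : LevelZeroData U ρ)
      (hc₄ : 0 < c₄) (hc₄' : c₄ ≤ 1), (h.schedule c₄ hc₄ hc₄').LevelWitness 1 0) :
    Summit.NavierStokesRegularity.NavierStokesRegularity.Theses.PalasekTowerBreakdown.EpisodeBase :=
  palasekTowerBreakdown_episodeBase_of_exists_slot_pushed_levelWitness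
    (palasekTowerBreakdown_exists_slot_pushed_of_exists_slot_levelWitness hex)

end Summit.NavierStokesRegularity.NavierStokesRegularity.Theorems

end
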